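import Literature.NumberTheory.PAdicHodge.AinfPSeriesContracting
import Literature.NumberTheory.EllipticCurves.FormalGroupMultiplicationPrimeDecompositionInt
import HarnessLib

/-!
# Fontaine's element `[t] ∈ ker θ ⊂ 𝔸_inf(F)` of a `p`-power-compatible sequence of torsion points of the formal
# group of an integral Weierstrass equation (the elliptic analogue of `[ε] − 1`)

Topic `Literature/NumberTheory/PAdicHodge`; assembly of `AinfFontaineLimit` (Fontaine's limit for a contracting map),
`AinfPSeriesContracting` (`P = p·f + g(X^p)` is contracting) and
`EllipticCurves/FormalGroupMultiplicationPrimeDecompositionInt` (Silverman AEC IV.4.4 over `ℤ`). For a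
Weierstrass equation `W` over `ℤ` (e.g. a global minimal model of an elliptic curve over `ℚ`), a prime `p` and a
`p`-adic field `F`:

* `mulP W` — multiplication by `p` on the points `Ŵ(𝔫)` of the formal group with values in the nil ideal
  `𝔫 = θ⁻¹(𝔪_{ℂ_F}) ⊂ 𝔸_inf(F)` (evaluation of the integral series `[p]_W ∈ ℤ⟦T⟧`), and `mulPC W` — the same on
  `Ŵ(𝔪_{ℂ_F})`; `θ ∘ [p] = [p] ∘ θ` (`theta_mulP`), `σ ∘ [p] = [p] ∘ σ` (`gal_mulP`);
* **`isContracting_mulP`** — `[p]_W` is contracting for the `(p, ξ)`-adic filtration (AEC IV.4.4);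
* for a **`p`-power-compatible sequence of torsion points** `t : ℕ → Ŵ(𝔪_{ℂ_F})` (`[p] t_{n+1} = t_n`, `t_0 = 0`,
  i.e. an element of the Tate module `T_p Ŵ(𝒪_{ℂ_F})`) and ANY lifts `ûₙ ∈ 𝔫` (`θ ûₙ = tₙ`):
  **`torsionLift W t` := `lim [pⁿ]_W(ûₙ) ∈ 𝔸_inf(F)`** exists (`tendsto_torsionLift`), does not depend on the lifts
  (`torsionLift_eq_flim`), lies in `ker θ` (`theta_torsionLift`), and is `Γ_F`-equivariant
  (`gal_torsionLift : σ[t] = [σ t]`, `σ t = galSeq σ t`).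

This is Fontaine's / Colmez's first step towards the `p`-adic periods of `Ŵ` (Fontaine, *Groupes `p`-divisibles
sur les corps locaux* (1977) Ch. V §1; Colmez, *Périodes `p`-adiques des variétés abéliennes*, Math. Ann. 292
(1992) §2): the period of the invariant differential is then `∫_t ω = log_Ŵ([t])`, convergent `ξ`-adically in
`B_dR⁺` exactly as `t = log[ε]` (tree `BdRPlusLog`) because `[t] ∈ ker θ` — not done here.
Definitions (reviewed): `mulP`, `mulPC`, `lift`, `galSeq`, `galLift`, `torsionLift`. No named facts, no `sorry`. BSD / K★: infrastructure for
the supersingular sector of hDR; no statement about elliptic curves over number fields is proved here.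

## References
* J.-M. Fontaine, *Le corps des périodes p-adiques*, Astérisque 223 (1994), Exp. II §1.2 (`[ε]`, `θ`). [FontaineAsterisque223III]
* J. H. Silverman, *The Arithmetic of Elliptic Curves* (2009), IV.4.4, IV.2–IV.3 (`Ŵ(𝔪)`, torsion). [SilvermanAEC2009]
* J.-P. Serre, *Local class field theory* (Cassels–Fröhlich Ch. VI) §3.2. [CasselsFrohlichANT1967]
-/

noncomputable section

open Ideal Filter Topology Field WittVector MvPowerSeries

namespace Literature.NumberTheory.PAdicHodge

open Literature.NumberTheory.GaloisRepresentations
open Literature.NumberTheory.GaloisRepresentations.IsNonarchimedeanLocalField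
open Literature.NumberTheory.GaloisRepresentations.LubinTate

namespace AinfTop

variable {F : Type} [Field F] [ValuativeRel F] [TopologicalSpace F] [IsNonarchimedeanLocalField F]
  {p : ℕ} [Fact p.Prime] [Fact (¬ IsUnit (p : integerC F))]
  [IsAdicComplete (Ideal.span {(p : integerC F)}) (integerC F)] [CharZero F]
  {hθ : Function.Surjective (fontaineTheta (integerC F) p)}
  (W : WeierstrassCurve ℤ)

/-! ## §1 Multiplication by `p` on `Ŵ(𝔫)` and on `Ŵ(𝔪_{ℂ_F})` -/

/-- **`[p]_W` on `Ŵ(𝔫)`**: evaluation of the integral multiplication-by-`p` series of `W` at points of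
`𝔫 ⊂ 𝔸_inf(F)`. [cite: SilvermanAEC2009, IV.2–IV.3] -/
def mulP (a : (nilTheta F p hθ).toIdeal) : (nilTheta F p hθ).toIdeal :=
  evalPt₁ (nilTheta F p hθ) (W.formalMul p) (W.constantCoeff_formalMul p) a

variable (F p) in
/-- **`[p]_W` on `Ŵ(𝔪_{ℂ_F})`**. [cite: SilvermanAEC2009, IV.2–IV.3] -/
def mulPC (t : (maxNilIdealC F).toIdeal) : (maxNilIdealC F).toIdeal :=
  evalPt₁ (maxNilIdealC F) (W.formalMul p) (W.constantCoeff_formalMul p) t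

omit [CharZero F] [IsAdicComplete (Ideal.span {(p : integerC F)}) (integerC F)] [Fact (¬ IsUnit (p : integerC F))]
  [Fact p.Prime] in
/-- `θ` is compatible with the `ℤ`-algebra structures. [folklore] -/
private theorem theta_algebraMap_int [Fact p.Prime] [Fact (¬ IsUnit (p : integerC F))]
    [IsAdicComplete (Ideal.span {(p : integerC F)}) (integerC F)] (a : ℤ) :
    theta F p (algebraMap ℤ (AinfTop F p) a) = algebraMap ℤ (CBall F) a := by
  rw [algebraMap_int_eq, algebraMap_int_eq, eq_intCast, eq_intCast, map_intCast]

omit [CharZero F] [IsAdicComplete (Ideal.span {(p : integerC F)}) (integerC F)] in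
/-- `σ` is compatible with the `ℤ`-algebra structure. [folklore] -/
private theorem gal_algebraMap_int (σ : absoluteGaloisGroup F) (a : ℤ) :
    gal F p σ (algebraMap ℤ (AinfTop F p) a) = algebraMap ℤ (AinfTop F p) a := by
  rw [algebraMap_int_eq, eq_intCast, map_intCast]

/-- **`θ ∘ [p] = [p] ∘ θ`.** [cite: CasselsFrohlichANT1967, Ch. VI §3.2] -/
theorem theta_mulP (a : (nilTheta F p hθ).toIdeal) :
    theta F p (mulP W a : AinfTop F p) = (mulPC F p W ⟨theta F p a, theta_mem_maxNilIdealC a.2⟩ : CBall F) :=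
  theta_evalPt theta_algebraMap_int _ (W.constantCoeff_formalMul p) (fun _ : Unit => a)
    (fun _ : Unit => ⟨theta F p a, theta_mem_maxNilIdealC a.2⟩) fun _ => rfl

/-- **`σ ∘ [p] = [p] ∘ σ`** on `Ŵ(𝔫)`. [cite: FontaineAsterisque223III, Exp. II §1.2] -/
theorem gal_mulP (σ : absoluteGaloisGroup F) (a : (nilTheta F p hθ).toIdeal) :
    gal F p σ (mulP W a : AinfTop F p) = (mulP W ⟨gal F p σ a, gal_mem_nilTheta σ a.2⟩ : AinfTop F p) :=
  gal_evalPt σ (gal_algebraMap_int σ) _ (W.constantCoeff_formalMul p) (fun _ : Unit => a)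
    (fun _ : Unit => ⟨gal F p σ a, gal_mem_nilTheta σ a.2⟩) fun _ => rfl

/-- **`[p]_W` is contracting on `Ŵ(𝔫)`** (Silverman AEC IV.4.4: `[p] = p·f + g(T^p)` over `ℤ`).
[cite: SilvermanAEC2009, IV.4.4] -/
theorem isContracting_mulP : IsContracting hθ (mulP (hθ := hθ) W (F := F) (p := p)) :=
  isContracting_evalPt₁_of_decomp (W.constantCoeff_formalMul p) (W.constantCoeff_formalMulPRemPartInt (p := p))
    (W.constantCoeff_formalMulPDivPartInt (p := p)) (W.formalMul_prime_eq_add_subst_X_pow_int (p := p))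

/-- Iterates: `θ ∘ [p]ⁿ = [p]ⁿ ∘ θ`. [cite: CasselsFrohlichANT1967, Ch. VI §3.2] -/
theorem theta_mulP_iterate (n : ℕ) (a : (nilTheta F p hθ).toIdeal) :
    theta F p (((mulP W)^[n] a : (nilTheta F p hθ).toIdeal) : AinfTop F p) =
      (((mulPC F p W)^[n] ⟨theta F p a, theta_mem_maxNilIdealC a.2⟩ : (maxNilIdealC F).toIdeal) : CBall F) := by
  induction n generalizing a with
  | zero => rfl
  | succ n ih =>
    rw [Function.iterate_succ_apply, Function.iterate_succ_apply, ih]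
    congr 2
    exact Subtype.ext (theta_mulP W a)

/-! ## §2 `p`-power-compatible sequences of torsion points and their lifts -/

omit [CharZero F] [Fact p.Prime] [Fact (¬ IsUnit (p : integerC F))]
  [IsAdicComplete (Ideal.span {(p : integerC F)}) (integerC F)] in
/-- `[p]ᵏ t_{m+k} = t_m` for a `[p]`-compatible sequence. [cite: SilvermanAEC2009, IV.3] -/
theorem mulPC_iterate_eq {t : ℕ → (maxNilIdealC F).toIdeal} (htp : ∀ n, mulPC F p W (t (n + 1)) = t n) (m : ℕ) :
    ∀ k : ℕ, (mulPC F p W)^[k] (t (m + k)) = t m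
  | 0 => rfl
  | k + 1 => by
    rw [Function.iterate_succ_apply, ← Nat.add_assoc, htp, mulPC_iterate_eq htp m k]

/-- Lifts of a `[p]`-compatible sequence satisfy `[p] û_{n+1} ≡ ûₙ (mod (p, ξ))`. [cite: FontaineAsterisque223III, Exp. II §1.2.2] -/
theorem mulP_lift_sub_mem {t : ℕ → (maxNilIdealC F).toIdeal} (htp : ∀ n, mulPC F p W (t (n + 1)) = t n)
    {u : ℕ → (nilTheta F p hθ).toIdeal} (hu : ∀ n, theta F p (u n : AinfTop F p) = t n) (n : ℕ) :
    ((mulP W (u (n + 1)) : (nilTheta F p hθ).toIdeal) : AinfTop F p) - u n ∈ (WithIdeal.i : Ideal (AinfTop F p)) := by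
  refine sub_mem_ideal_of_theta_eq ?_
  rw [theta_mulP, hu n]
  have h : (⟨theta F p (u (n + 1) : AinfTop F p), theta_mem_maxNilIdealC (u (n + 1)).2⟩ : (maxNilIdealC F).toIdeal) =
      t (n + 1) := Subtype.ext (hu (n + 1))
  rw [h, htp]

/-- `θ([pⁿ] ûₙ) = [pⁿ] tₙ = t₀ = 0`. [cite: FontaineAsterisque223III, Exp. II §1.2.2] -/
theorem theta_approx_eq_zero {t : ℕ → (maxNilIdealC F).toIdeal} (ht0 : (t 0 : CBall F) = 0)
    (htp : ∀ n, mulPC F p W (t (n + 1)) = t n)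
    {u : ℕ → (nilTheta F p hθ).toIdeal} (hu : ∀ n, theta F p (u n : AinfTop F p) = t n) (n : ℕ) :
    theta F p (approx (mulP W) u n) = 0 := by
  rw [approx_def, theta_mulP_iterate]
  have h : (⟨theta F p (u n : AinfTop F p), theta_mem_maxNilIdealC (u n).2⟩ : (maxNilIdealC F).toIdeal) = t (0 + n) :=
    Subtype.ext (by rw [zero_add]; exact hu n)
  rw [h, mulPC_iterate_eq W htp 0 n, ht0]

/-! ## §3 Fontaine's element `[t]` -/

/-- A choice of lifts `ûₙ ∈ 𝔫` of the points `tₙ ∈ 𝔪_{ℂ_F}` (`θ` is onto). [cite: FontaineAsterisque223III, Exp. II §1.2.2] -/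
def lift (hθ : Function.Surjective (fontaineTheta (integerC F) p)) (t : ℕ → (maxNilIdealC F).toIdeal) (n : ℕ) :
    (nilTheta F p hθ).toIdeal :=
  Classical.choose (exists_theta_eq (hθ := hθ) (t n))

/-- The chosen lifts lift. [cite: FontaineAsterisque223III, Exp. II §1.2.2] -/
theorem theta_lift (t : ℕ → (maxNilIdealC F).toIdeal) (n : ℕ) : theta F p (lift hθ t n : AinfTop F p) = t n :=
  Classical.choose_spec (exists_theta_eq (hθ := hθ) (t n))

/-- **Fontaine's element `[t] = lim [pⁿ]_W(ûₙ) ∈ 𝔸_inf(F)`** of a `[p]`-compatible sequence `t` of points of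
`Ŵ(𝔪_{ℂ_F})` (for the chosen lifts; independent of them by `torsionLift_eq_flim`).
[cite: FontaineAsterisque223III, Exp. II §1.2.2] -/
def torsionLift (hθ : Function.Surjective (fontaineTheta (integerC F) p)) (t : ℕ → (maxNilIdealC F).toIdeal)
    (htp : ∀ n, mulPC F p W (t (n + 1)) = t n) : AinfTop F p :=
  flim (isContracting_mulP (hθ := hθ) W) (lift hθ t) (mulP_lift_sub_mem W htp (theta_lift t))

/-- **Independence of the lifts**: for ANY lifts `uₙ` of `tₙ`, `lim [pⁿ](uₙ) = [t]`.
[cite: FontaineAsterisque223III, Exp. II §1.2.2] -/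
theorem torsionLift_eq_flim {t : ℕ → (maxNilIdealC F).toIdeal} (htp : ∀ n, mulPC F p W (t (n + 1)) = t n)
    {u : ℕ → (nilTheta F p hθ).toIdeal} (hu : ∀ n, theta F p (u n : AinfTop F p) = t n) :
    torsionLift W hθ t htp = flim (isContracting_mulP (hθ := hθ) W) u (mulP_lift_sub_mem W htp hu) :=
  flim_congr _ _ _ fun n => sub_mem_ideal_of_theta_eq (by rw [theta_lift, hu])

/-- The approximants `[pⁿ](uₙ)` converge to `[t]`, for any lifts. [cite: FontaineAsterisque223III, Exp. II §1.2.2] -/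
theorem tendsto_torsionLift {t : ℕ → (maxNilIdealC F).toIdeal} (htp : ∀ n, mulPC F p W (t (n + 1)) = t n)
    {u : ℕ → (nilTheta F p hθ).toIdeal} (hu : ∀ n, theta F p (u n : AinfTop F p) = t n) :
    Tendsto (approx (mulP W) u) atTop (𝓝 (torsionLift W hθ t htp)) := by
  rw [torsionLift_eq_flim W htp hu]
  exact tendsto_approx_flim _ _

/-- **`θ([t]) = 0`**: Fontaine's element lies in `ker θ = ξ𝔸_inf` when `t₀ = 0`.
[cite: FontaineAsterisque223III, Exp. II §1.2.2] -/
theorem theta_torsionLift {t : ℕ → (maxNilIdealC F).toIdeal} (ht0 : (t 0 : CBall F) = 0)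
    (htp : ∀ n, mulPC F p W (t (n + 1)) = t n) : theta F p (torsionLift W hθ t htp) = 0 :=
  theta_flim_eq_zero _ _ (theta_approx_eq_zero W ht0 htp (theta_lift t))

variable (F) in
/-- The `σ`-translate of a sequence of points of `𝔪_{ℂ_F}`. [cite: FontaineAsterisque223III, Exp. II §1.2] -/
def galSeq (σ : absoluteGaloisGroup F) (t : ℕ → (maxNilIdealC F).toIdeal) (n : ℕ) : (maxNilIdealC F).toIdeal :=
  ⟨galCBall σ (t n), galCBall_mem (t n).2⟩

omit [Fact p.Prime] [Fact (¬ IsUnit (p : integerC F))] [IsAdicComplete (Ideal.span {(p : integerC F)}) (integerC F)]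
  [CharZero F] in
/-- Unfolding `galSeq`. [cite: FontaineAsterisque223III, Exp. II §1.2] -/
@[simp] theorem coe_galSeq (σ : absoluteGaloisGroup F) (t : ℕ → (maxNilIdealC F).toIdeal) (n : ℕ) :
    ((galSeq F σ t n : (maxNilIdealC F).toIdeal) : CBall F) = galCBall σ (t n) := rfl

/-- The `σ`-translate of the chosen lifts, as a sequence of points of `𝔫`. [cite: FontaineAsterisque223III, Exp. II §1.2] -/
def galLift (hθ : Function.Surjective (fontaineTheta (integerC F) p)) (σ : absoluteGaloisGroup F)
    (t : ℕ → (maxNilIdealC F).toIdeal) (n : ℕ) : (nilTheta F p hθ).toIdeal :=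
  ⟨gal F p σ (lift hθ t n), gal_mem_nilTheta σ (lift hθ t n).2⟩

/-- `θ(σ ûₙ) = σ tₙ`: the translated lifts lift the translated sequence. [cite: FontaineAsterisque223III, Exp. II §1.2] -/
theorem theta_galLift (σ : absoluteGaloisGroup F) (t : ℕ → (maxNilIdealC F).toIdeal) (n : ℕ) :
    theta F p (galLift hθ σ t n : AinfTop F p) = galSeq F σ t n := by
  apply Subtype.ext
  change ((theta F p (gal F p σ (lift hθ t n : AinfTop F p)) : CBall F) : CompletedAlgClosure F) = _
  rw [coe_theta_gal, theta_lift, coe_galSeq, coe_galCBall]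

/-- `σ` acts on `[p]`-compatible sequences of `Ŵ(𝔪_{ℂ_F})` (`σ ∘ [p] = [p] ∘ σ` on `𝒪_{ℂ_F}`-points, by transport
through `θ` and the lifts). [cite: FontaineAsterisque223III, Exp. II §1.2] -/
theorem mulPC_galSeq (hθ' : Function.Surjective (fontaineTheta (integerC F) p)) (σ : absoluteGaloisGroup F)
    {t : ℕ → (maxNilIdealC F).toIdeal} (htp : ∀ n, mulPC F p W (t (n + 1)) = t n) (n : ℕ) :
    mulPC F p W (galSeq F σ t (n + 1)) = galSeq F σ t n := by
  -- `θ(σ [p] û_{n+1}) = [p](θ(σ û_{n+1})) = [p](σ t_{n+1})` and `θ(σ [p] û_{n+1}) = σ θ([p] û_{n+1}) = σ t_n`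
  have h1 : theta F p (gal F p σ (mulP W (lift hθ' t (n + 1)) : AinfTop F p)) =
      (mulPC F p W (galSeq F σ t (n + 1)) : CBall F) := by
    rw [gal_mulP, theta_mulP]
    congr 2
    exact Subtype.ext (theta_galLift (hθ := hθ') σ t (n + 1))
  have h2 : theta F p (gal F p σ (mulP W (lift hθ' t (n + 1)) : AinfTop F p)) = (galSeq F σ t n : CBall F) := by
    apply Subtype.ext
    rw [coe_theta_gal, theta_mulP, coe_galSeq, coe_galCBall]
    have h : (⟨theta F p (lift hθ' t (n + 1) : AinfTop F p), theta_mem_maxNilIdealC (lift hθ' t (n + 1)).2⟩ :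
        (maxNilIdealC F).toIdeal) = t (n + 1) := Subtype.ext (theta_lift t (n + 1))
    rw [h, htp]
  exact Subtype.ext (h1.symm.trans h2)

/-- **`Γ_F`-equivariance of Fontaine's element: `σ[t] = [σ t]`.** [cite: FontaineAsterisque223III, Exp. II §1.2] -/
theorem gal_torsionLift (σ : absoluteGaloisGroup F) {t : ℕ → (maxNilIdealC F).toIdeal}
    (htp : ∀ n, mulPC F p W (t (n + 1)) = t n) :
    gal F p σ (torsionLift W hθ t htp) = torsionLift W hθ (galSeq F σ t) (mulPC_galSeq W hθ σ htp) := by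
  have hsu : ∀ n, ((mulP W (galLift hθ σ t (n + 1)) : (nilTheta F p hθ).toIdeal) : AinfTop F p) - galLift hθ σ t n ∈
      (WithIdeal.i : Ideal (AinfTop F p)) :=
    mulP_lift_sub_mem W (mulPC_galSeq W hθ σ htp) (theta_galLift σ t)
  rw [torsionLift, torsionLift_eq_flim W (mulPC_galSeq W hθ σ htp) (theta_galLift σ t)]
  exact map_flim (isContracting_mulP (hθ := hθ) W) (continuous_gal σ)
    (fun a => ⟨gal F p σ a, gal_mem_nilTheta σ a.2⟩) (fun _ => rfl) (fun a => Subtype.ext (gal_mulP W σ a))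
    (u := lift hθ t) (su := galLift hθ σ t) (fun _ => rfl) (mulP_lift_sub_mem W htp (theta_lift t)) hsu

end AinfTop

end Literature.NumberTheory.PAdicHodge

end
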